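import Mathlib
import HarnessLib
import HarnessLib.Audit
import Summits.AtomisticToContinuum.Statement
import Literature.MathematicalPhysics.QuantumManyBody.PeriodicBoseGas
import Summits.AtomisticToContinuum.BoseEinsteinCondensation.Theorems.BECGroundStateSOSPeriodicEnergyFinite
import Summits.AtomisticToContinuum.BoseEinsteinCondensation.Theorems.BECSectorPoincareTwoScaleScatteringLengthFinite
import HarnessLib.Audit.Status.Attr

/-!
Route: BECRewardDescent

# Route BECRewardDescent — buy the torus condensate with a reward θρa·n̂₊, then walk the price to
zero along an integrable √s pseudo-Goldstone susceptibility

It suffices to show X = RewardScaleChord ∧ RewardChordBound ∧ BoundaryTransferWeak (card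
reward-walk-gmor-descent, gen-2 conforming re-filing of retired route BECRewardWalk). Torus of side
L = (N/ρ)^(1/3); reward functional F_s(Ψ) = ⟨Ψ,HΨ⟩ + s·(N − ⟨Ψ,n̂₀Ψ⟩) on periodic C¹ trial states,
R(s) = inf F_s, so R(0) = E₀^per and R is concave with R′(s) = depletion of the ground state of H +
s·n̂₊. RewardScaleChord (RUNG 1, from PROVED cone facts + a condensed trial state): for all τ, θ >
0, at small density, every reward s ≥ θρa lifts the ground-state energy by at most sτN, R(s) ≤
E₀^per + sτN — thermodynamic-limit condensation of the REWARDED gas at a price s/μ = θ/8π as small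
as we please. RewardChordBound (RUNG 2, the walk): for every τ > 0 there is θ > 0 with chord(s) ≤
chord(θρa) + τN for all 0 < s ≤ θρa, i.e. ∫₀^θρa χ ≤ τN for the condensate-number susceptibility χ =
−R″. The deciding theorem (glue.lean, sorry-free, two cases θρa = 0 / > 0 and ℝ≥0∞ chord algebra)
turns the two rungs into R(s) ≤ E₀ + 2sτN on (0, s₁], feeds that with PeriodicEnergyFinite and the
shared torus rigidity PeriodicRigidity (stmt-8958) into the provable-now support RigidCondensation
(δ-near-minimisers have n₀ ≥ N/2), and BoundaryTransferWeak (shared stmt-0827) carries torus BEC to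
the Dirichlet conjunct `BoseEinsteinCondensation`. The MECHANISM for RewardChordBound is filed as
the two conditional Bogoliubov cruxes SectorGap (rank 2) and CondensateVariance (rank 3) plus the
support WalkGlue (χ ≤ 2Var(n̂₀)/Δ_(P=0), Δ ≥ c√(ρa s), bootstrap in s at fixed (N,L)).
Lean: `(∀ v : ℝ → ENNReal,
Literature.MathematicalPhysics.QuantumManyBody.BoseGas.IsRepulsiveFiniteRange v → ∀ τ θ : ℝ, 0 < τ →
0 < θ → ∃ ρ₀ : ℝ, 0 < ρ₀ ∧ ∀ ρ : ℝ, 0 < ρ → ρ < ρ₀ → ∀ᶠ N : ℕ in Filter.atTop, ∀ s : ℝ, 0 < s → θ *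
ρ * (Literature.MathematicalPhysics.QuantumManyBody.BoseGas.scatteringLength v).toReal ≤ s → let L :
ℝ := Literature.MathematicalPhysics.QuantumManyBody.BoseGas.sideLength ρ N; (⨅ Ψ :
Literature.MathematicalPhysics.QuantumManyBody.BoseGas.PeriodicTrialState N L,
(Literature.MathematicalPhysics.QuantumManyBody.BoseGas.periodicEnergy v Ψ + ENNReal.ofReal s * ((N
: ENNReal) - Literature.MathematicalPhysics.QuantumManyBody.BoseGas.condensateOccupation N L Ψ.ψ)))
≤ Literature.MathematicalPhysics.QuantumManyBody.BoseGas.periodicGroundStateEnergy v N L +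
ENNReal.ofReal (s * τ * N)) ∧ (∀ v : ℝ → ENNReal,
Literature.MathematicalPhysics.QuantumManyBody.BoseGas.IsRepulsiveFiniteRange v → ∀ τ : ℝ, 0 < τ → ∃
θ ρ₀ : ℝ, 0 < θ ∧ 0 < ρ₀ ∧ ∀ ρ : ℝ, 0 < ρ → ρ < ρ₀ → ∀ᶠ N : ℕ in Filter.atTop, ∀ s : ℝ, 0 < s → s ≤
θ * ρ * (Literature.MathematicalPhysics.QuantumManyBody.BoseGas.scatteringLength v).toReal → let L :
ℝ := Literature.MathematicalPhysics.QuantumManyBody.BoseGas.sideLength ρ N; let s₀ : ℝ := θ * ρ *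
(Literature.MathematicalPhysics.QuantumManyBody.BoseGas.scatteringLength v).toReal; let R : ℝ →
ENNReal := fun t => ⨅ Ψ : Literature.MathematicalPhysics.QuantumManyBody.BoseGas.PeriodicTrialState
N L, (Literature.MathematicalPhysics.QuantumManyBody.BoseGas.periodicEnergy v Ψ + ENNReal.ofReal t *
((N : ENNReal) - Literature.MathematicalPhysics.QuantumManyBody.BoseGas.condensateOccupation N L
Ψ.ψ)); R s + ENNReal.ofReal (s / s₀) *
Literature.MathematicalPhysics.QuantumManyBody.BoseGas.periodicGroundStateEnergy v N L ≤
Literature.MathematicalPhysics.QuantumManyBody.BoseGas.periodicGroundStateEnergy v N L +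
ENNReal.ofReal (s / s₀) * R s₀ + ENNReal.ofReal (s * τ * N)) ∧ (∀ v : ℝ → ENNReal,
Literature.MathematicalPhysics.QuantumManyBody.BoseGas.IsRepulsiveFiniteRange v → (∃ ρ₀ : ℝ, 0 < ρ₀
∧ ∀ ρ : ℝ, 0 < ρ → ρ < ρ₀ → ∃ c : ℝ, 0 < c ∧ ∀ᶠ N : ℕ in Filter.atTop, ∃ δ : ENNReal, 0 < δ ∧ ∀ Ψ :
Literature.MathematicalPhysics.QuantumManyBody.BoseGas.PeriodicTrialState N
(Literature.MathematicalPhysics.QuantumManyBody.BoseGas.sideLength ρ N),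
Literature.MathematicalPhysics.QuantumManyBody.BoseGas.periodicEnergy v Ψ ≤
Literature.MathematicalPhysics.QuantumManyBody.BoseGas.periodicGroundStateEnergy v N
(Literature.MathematicalPhysics.QuantumManyBody.BoseGas.sideLength ρ N) + δ → ENNReal.ofReal (c * N)
≤ Literature.MathematicalPhysics.QuantumManyBody.BoseGas.condensateOccupation N
(Literature.MathematicalPhysics.QuantumManyBody.BoseGas.sideLength ρ N) Ψ.ψ) → ∃ ρ₀ : ℝ, 0 < ρ₀ ∧ ∀
ρ : ℝ, 0 < ρ → ρ < ρ₀ → Literature.MathematicalPhysics.QuantumManyBody.BoseGas.HasGroundStateBEC v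
ρ)`

## Assembly
Real proof, not an implication item (glue.lean = `closes`, rc 0 with the 12 decls in Sketch.lean;
axioms propext / Classical.choice / Quot.sound). Fix v repulsive finite-range. RewardChordBound with
τ = 1/8 gives θ, ρ₁; RewardScaleChord with (τ = 1/8, θ) gives ρ₂; PeriodicEnergyFinite ρ₃;
PeriodicRigidity ρ₄. For ρ < min ρᵢ and eventually in N (intersection of the four eventual sets),
with s₀ := θρ·a.toReal ≥ 0: if s₀ = 0 (a = 0), RewardScaleChord holds for every s > 0 and gives R(s)
≤ E₀ + sN/8 ≤ E₀ + sN/4 on (0,1]; if s₀ > 0, for 0 < s ≤ s₀ the chord bound R(s) + (s/s₀)E₀ ≤ E₀ +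
(s/s₀)R(s₀) + sN/8 and the rung R(s₀) ≤ E₀ + s₀N/8 give, after ENNReal.ofReal_mul and cancelling the
finite term (s/s₀)E₀ (E₀ ≠ ⊤, ENNReal.add_le_add_iff_right), R(s) ≤ E₀ + s(2·1/8)N on (0, s₀].
Either way RigidCondensation (τ = 1/4) with PeriodicEnergyFinite and the rigidity body yields δ > 0
with n₀(Ψ) ≥ (1 − 1/2)N for every δ-near-minimiser: the PeriodicBEC body for v with c = 1/2, and
BoundaryTransferWeak(v) turns it into ∃ρ₀ ∀ρ∈(0,ρ₀) HasGroundStateBEC v ρ, i.e. the sub-problem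
Statement decl `BoseEinsteinCondensation`. SectorGap, CondensateVariance, CondensedTrialState,
ScatteringLengthFinite and WalkGlue enter through the proofs of RewardChordBound / RewardScaleChord,
not through `closes`. Deciding theorem: `theorem closes (hRS : RewardScaleChord) (hCB :
RewardChordBound) (hFin : PeriodicEnergyFinite) (hRig : PeriodicRigidity) (hRC : RigidCondensation)
(hBT : BoundaryTransferWeak) : BoseEinsteinCondensation`.

Rationale: WHY THIS LINE. Lauwers–Verbeure–Zagrebnov proved BEC for interacting superstable bosons once the
one-particle spectrum has a gap Δ ≥ Δ_min above its ground mode and left "BEC for homogeneous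
systems when the gap tends to zero" open (LauwersVerbeureZagrebnov2003, Thm 2 and §3); this route is
that programme at T = 0, made quantitative, with a NUMBER-CONSERVING U(1)-invariant gap: the reward
−s·n̂₀ = −sN + s·n̂₊. Its top rung needs no Δ_min — the PROVED Lieb–Yngvason lower bound
`Literature.MathematicalPhysics.QuantumManyBody.BoseGas.LSSY2005_lowerBound_periodic_holds`
(LSSY2005 Thm 2.4) and a condensed near-optimal trial state (energy side PROVED:
`LSSY2005_upperBound_periodic_holds`, Thm 2.2; condensation of the trial state =
CondensedTrialState) give condensation at s = θρa ≪ μ = 8πρa, the reward-space twin of Fournais2020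
Thm 1.2 and of the n₊/L² penalties of FournaisEtAl2024 Thm 1.3 / Junge2026 Thm 4 (dictionary s ↔ ℓ⁻²
↔ λ/√ρ). The descent s ↓ 0 is a Hellmann–Feynman / analytic-perturbation walk (Kato1966; convexity
in a source as in Griffiths1966, LiebSeiringerYngvason2005): because the reward couples to a₀†a₀,
the SQUARE of the order parameter, the P = 0 gap of H + s·n̂₊ opens like the Gell-Mann–Oakes–Renner
square root 2√(2μs) (Bogoliubov pair energy 2√((k²+s)(k²+s+2μ))) while Var(n̂₀) = Σ2u_k²v_k² ≈
2√π√(ρa³)N is infrared-finite exactly in d = 3, so χ ≤ 2Var/Δ ≲ N/√(ρa s) is integrable at 0 and the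
walk costs (4C√θ/c)N. Imported from operator theory: analytic perturbation of isolated eigenvalues
and second-order (Feshbach/Temple-type) susceptibility bounds; from chiral perturbation theory only
the structural analogy m_π² ∝ m_q. What no prior or open route does: BECPinning (retired) fixed the
pinning strength at κ/L²; BECJosephsonSlackThreshold asks condensation of ALL κN/L²-near-minimisers;
BECDensityChord walks a secant in ρ at fixed N; here TL BEC is reduced to Bogoliubov spectral
statements for states ALREADY condensed (by the bootstrap) and BULK-GAPPED (by the reward) — the
most accessible open spectral problem of the subject (BoccatoEtAl2019Acta,
BrenneckeCaporalettiSchlein2022, BrenneckeEtAl2024 in GP/GP+κ boxes; DerezinskiNapiorkowski2014 in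
the mean-field TL). Negatives index (6 entries, 1 on this sub: SwapJensen) not touched.

RANKED CRUXES. #2 SectorGap (crux) — (card BOOT(a)/FIN(a), merged) for every repulsive finite-range
v there are η, c, ρ₀ > 0 such that for 0 < ρ < ρ₀, all large N (L = (N/ρ)^(1/3), a = scattering
length) and every reward 0 < s ≤ ρa: IF the near-minimisers of F_s are (1−η)-condensed (∃δ>0: F_s(Ψ)
≤ R(s)+δ ⇒ n₀(Ψ) ≥ (1−η)N) THEN the zero-total-momentum sector has spectral gap ≥ c√(ρa)√s above
R(s), in Ky-Fan form: F_s(Φ₁) + F_s(Φ₂) ≥ 2R(s) + c√(ρa s) for every pair of L²(cell^N)-orthogonal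
periodic trial states invariant under simultaneous translation of all particles. Bogoliubov value:
pair energy 2√((4π²/L²+s)(4π²/L²+s+16πρa)) ≥ 8√π·√(ρa s), i.e. c = 8√π. [difficulty: open-problem]
(why it might fail: Bogoliubov's P=0 gap is proved only in GP/GP+κ boxes (BoccatoEtAl2019Acta,
BrenneckeCaporalettiSchlein2022); at L=(N/ρ)^(1/3) there are N√(ρa³) excitations, cubic/quartic
terms are not norm-small, and a soft collective P=0 mode below c√(ρa s) would refute c uniform in
N.) [BoccatoEtAl2019Acta, BrenneckeCaporalettiSchlein2022, BrenneckeEtAl2024,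
DerezinskiNapiorkowski2014, Seiringer2011, ChongLiangNam2026, LSSY2005, arXiv:1801.01389]
#3 CondensateVariance (crux) — (card BOOT(b)/FIN(b)) for every repulsive finite-range v there are η,
C, ρ₀ > 0 such that for 0 < ρ < ρ₀, all large N and every 0 < s ≤ ρa: IF the near-minimisers of F_s
are (1−η)-condensed THEN for some δ > 0 every δ-near-minimiser Ψ of F_s has ⟨Ψ, n̂₀²Ψ⟩ ≤ ⟨Ψ,n̂₀Ψ⟩² +
C·N, i.e. Var_Ψ(n̂₀) ≤ CN, where ⟨Ψ,n̂₀²Ψ⟩ = ‖Σ_i P_iΨ‖² = L⁻⁶∫_(cell^N)|Σ_i∫_cell Ψ(X[i↦y])dy|²dX.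
Bogoliubov value at T = 0: Var(n̂₀) = Σ_k 2u_k²v_k² ≈ 2√π·√(ρa³)·N, infrared-finite (∫d³k/k²)
exactly in d = 3. [difficulty: XL] (why it might fail: Needs a 4-point bound for condensed states at
L=(N/ρ)^(1/3), quartic in excitation operators — exactly where TL Bogoliubov control is missing;
anomalous fluctuations Var(n̂₀) ≫ N (GiorginiPitaevskiiStringari1998 find N^(4/3) canonically at
T>0) would break the walk.) [LiebSeiringerYngvason2005, BoccatoEtAl2019Acta,
GiorginiPitaevskiiStringari1998, BrenneckeCaporalettiSchlein2022, LSSY2005]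
#4 RewardChordBound (crux) — (card WALK/RUNG 2, output form) for every repulsive finite-range v and
every τ > 0 there are θ, ρ₀ > 0 such that for 0 < ρ < ρ₀ and all large N: for all 0 < s ≤ s₀ := θρa,
chord(s) ≤ chord(s₀) + τN, written subtraction-free as R(s) + (s/s₀)E₀^per ≤ E₀^per + (s/s₀)R(s₀) +
sτN. Equivalently R′(0⁺) − R′(s₀⁻) = ∫₀^s₀ χ(s)ds ≤ τN: removing a reward of strength ≤ θμ/8π
changes the ground-state depletion by at most τN (Bogoliubov: by O(√(ρa³)N·θ log(1/θ))). Vacuous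
when a = 0. [deps: RewardScaleChord, SectorGap, CondensateVariance, WalkGlue] [difficulty:
open-problem] (why it might fail: Unconditional TL statement: with RewardScaleChord and rigidity it
yields torus BEC, so off the WalkGlue path it is as hard as PeriodicBEC; false iff removing a reward
≤ θμ/8π moves the ground-state depletion by ≥ τN at arbitrarily small ρ (non-integrable χ, as in d ≤
2).) [LauwersVerbeureZagrebnov2003, Kato1966, Griffiths1966, LiebSeiringerYngvason2005, LSSY2005]
#5 RewardScaleChord (crux) — (card RS/RUNG 1, chord form) for every repulsive finite-range v and all
τ, θ > 0 there is ρ₀ > 0 such that for 0 < ρ < ρ₀, all large N (L = (N/ρ)^(1/3)) and every s ≥ θρ·a,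
s > 0: R(s) ≤ E₀^per(N,L) + sτN; consequently every δ-near-minimiser of F_s has depletion ≤ τN + δ/s
— thermodynamic-limit condensation of the REWARDED torus gas at a price s with s/μ = θ/8π
arbitrarily small. Proof route: R(s) ≤ F_s(Φ) ≤ 4πaρ(1+η)N + sηN for the condensed trial state Φ of
CondensedTrialState, and E₀^per ≥ 4πρa(1 − C Y^(1/17))N by the PROVED
LSSY2005_lowerBound_periodic_holds; choose η ≤ min(τ/2, θτ/16π) and C Y^(1/17) ≤ θτ/16π. At a = 0 (v
= 0 a.e.) it holds for all s > 0 with Φ = constant. [deps: CondensedTrialState,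
ScatteringLengthFinite] [difficulty: M] (why it might fail: Energy inputs are PROVED in-tree (LSSY
Thms 2.2/2.4), but the rung needs a CONDENSED near-optimal C¹ periodic trial state at L=(N/ρ)^(1/3)
(CondensedTrialState: Jastrow 1-pdm by cluster expansion, or glued GP boxes; hard cores need C¹
profiles) — not in print as stated.) [LSSY2005, LiebYngvason1998, LauwersVerbeureZagrebnov2003,
Fournais2020, FournaisEtAl2024, Junge2026, PenroseOnsager1956, arXiv:2605.06844]
#6 BoundaryTransferWeak (crux) — (shared verbatim with stmt-AtomisticToContinuum-0827) for each
repulsive finite-range v, PeriodicBEC(v) — ∃ρ₀ ∀ρ<ρ₀ ∃c>0 ∀ᶠN ∃δ>0: every δ-near-minimiser of the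
periodic energy at L = (N/ρ)^(1/3) has n₀ ≥ cN — implies ∃ρ₀>0 ∀ρ∈(0,ρ₀) HasGroundStateBEC v ρ
(Dirichlet ground state, λ_max(γ) ≥ cN via condensateNumber): the mode-free boundary-condition
transfer; expected route: Neumann bracketing of interior sub-boxes + a mode-free criterion (λ_max ≥
tr γ²/N). Alternative for THIS line if it stalls: run the whole walk in the Dirichlet box with the
reward on the flat mode (card item TR). [difficulty: L] (why it might fail: PeriodicBEC(v) is
ground-state-only (δ after N) at the box (N/ρ)^(1/3): the Dirichlet GS is not a periodic
near-minimiser (wall term ≫ δ), interior restrictions are neither periodic nor of sharp N, so the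
hypothesis may never fire (transfer ≈ conjunct); BEC is BC-sensitive (Robinson1976).)
[LiebSeiringerSolovejYngvason2005, Basti2022, BoccatoSeiringer2023, Junge2026, Robinson1976,
LauwersVerbeureZagrebnov2003]
#9 ScatteringLengthFinite (support) — (shared verbatim with stmt-AtomisticToContinuum-0851) finite
range ⇒ scatteringLength v ≠ ⊤ (trial φ ∈ C¹, φ = 0 on B_R₀, φ = 1 off B_(R₀+ε); hard cores fine
since ⊤·0 = 0). Needed to read a := (scatteringLength v).toReal inside the proof of RewardScaleChord
(LSSY facts carry the hypothesis a ≠ ⊤). [difficulty: provable-now] [LSSY2005]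
#9 PeriodicEnergyFinite (support) — (shared verbatim with stmt-AtomisticToContinuum-3974) for every
repulsive finite-range v there is ρ₀ > 0 such that for 0 < ρ < ρ₀ and all large N the periodic
ground-state energy at L = (N/ρ)^(1/3) is finite — immediate from the PROVED upper bound
LSSY2005_upperBound_periodic_holds (N ≥ 2, 2R₀ < L, a/b ≤ c(v)) and ScatteringLengthFinite. Needed
to cancel finite terms in ℝ≥0∞ in `closes` and in RigidCondensation. [difficulty: provable-now]
[LSSY2005]
#9 PeriodicRigidity (support) — (shared verbatim with stmt-AtomisticToContinuum-8958, torus twin of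
BECPalmLandscape.GroundStateRigidity) ∀ admissible v ∃ρ₀ ∀ρ<ρ₀ ∀ᶠ N ∀η>0 ∃δ>0: any two periodic
δ-near-minimisers Ψ, Φ on the torus of side (N/ρ)^(1/3) satisfy ∫_(cell^N)|Ψ − cΦ|² ≤ η for some
unit complex c (compact resolvent, unique positive ground state by positivity improvement, spectral
gap at fixed N; hard cores via connectivity of the dilute component of configuration space — the
point flagged on 8958). Only the s = 0 rigidity is needed by `closes`; at s > 0 the reward's
strictly positive kernel makes the ground state unique inside WalkGlue. [difficulty: M]
[ReedSimonIV1978, Kato1966, BaryshnikovBubenikKahle2013, DiaconisLebeauMichel2010, LSSY2005]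
#9 RigidCondensation (support) — (new, deterministic at each (v, ρ, N, τ); the step `closes`
consumes) if E₀^per(N,L) < ∞ (L = (N/ρ)^(1/3)), the rigidity body of PeriodicRigidity holds at (ρ,
N), and R(s) ≤ E₀^per + sτN for all s in some interval (0, s₁], then for some δ > 0 every
δ-near-minimiser Ψ of the periodic energy has n₀(Ψ) ≥ (1 − 2τ)N. Proof (provable now): pick s ≤ s₁
and an ε-minimiser Φ of F_s with ε = sτN/2; then periodicEnergy Φ ≤ E₀ + (3/2)sτN =: E₀ + δ′ and N −
n₀(Φ) ≤ (3/2)τN; by rigidity (η with 2√η ≤ τ/2) every δ′-near-minimiser Ψ is L²(cell^N)-close to cΦ,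
and √(n₀(·)/N) = ‖AΨ‖ with (AΨ)(Y) = ⟨φ₀, Ψ(·,Y)⟩, ‖A‖ ≤ 1, is 1-Lipschitz, so n₀(Ψ)/N ≥ (√(1 −
3τ/2) − √η)² ≥ 1 − 2τ (trivial for τ ≥ 1/2; N = 0 fine). In-tree slice lemmas:
condensateOccupation_succ, lintegral_cellN_succ, measurePreserving_vecCons. [difficulty:
provable-now] [ReedSimonIV1978, LSSY2005, Fournais2020]
#9 CondensedTrialState (support) — for every repulsive finite-range v and η > 0, at small density
and for all large N there is a periodic C¹ Bose-symmetric normalised trial state Φ on the torus of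
side (N/ρ)^(1/3) with periodicEnergy ≤ 4πaρ(1+η)N AND condensateOccupation ≥ (1−η)N. Candidates: (i)
the in-tree Jastrow/Dyson product `IsPairProfile.trialState` (Π f(x_i−x_j), f = 1 beyond b, a/η ≲ b
≪ ρ^(-1/3)) whose energy is the proof of LSSY2005 Thm 2.2 and whose one-particle density matrix is a
two-ghost insertion ratio of canonical partition functions of the classical gas with pair weight f²
(Penrose–Onsager), controlled by a convergent cluster expansion in ρ∫(1−f²) ~ ρab²; (ii) symmetrised
products of Dirichlet GP-box ground states (box side √(g/ρa), g = g(η) large, complete BEC in the GP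
limit LiebSeiringer2002 / LSSY2005 Thm 7.1) glued with corridors; a = 0: Φ = constant. [difficulty:
L] [LSSY2005, LiebSeiringer2002, PenroseOnsager1956, PulvirentiTsagkarogiannis2012, Ueltschi2006,
arXiv:2605.06844]
#9 WalkGlue (support) — (glue of the foreseen split RewardChordBound ⇐ RewardScaleChord, SectorGap,
CondensateVariance; kind glue, filed as support) RewardScaleChord → SectorGap → CondensateVariance →
RewardChordBound. Content, at fixed (N,L): for every s > 0, H + s·n̂₊ has a unique, positive,
translation-invariant ground state Ψ_s (e^(ts n̂₀) ≥ (ts)^N L^(−3N) has a strictly positive kernel,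
e^(−tH) preserves positivity even with hard cores), so R is concave and real-analytic on (0,∞) with
R′(s) = n₊(Ψ_s) and −R″(s) = 2Σ_m|⟨m|n̂₀|Ψ_s⟩|²/(E_m−E₀) ≤ 2Var_(Ψ_s)(n̂₀)/Δ_(P=0)(s) (Kato; Ky-Fan
gap from SectorGap; δ-near-minimisers of F_s converge to Ψ_s, so the cruxes' hypotheses at s follow
from n₊(Ψ_s) ≤ ηN/2); bootstrap: S = {s ∈ (0,s₀] : n₊(Ψ_u) ≤ ηN/2 on [s,s₀]} is closed, and open by
RewardScaleChord(η/4, θ) (n₊(Ψ_s₀) ≤ chord(s₀) ≤ ηN/4) plus ∫_s^s₀ 2CN/(c√(ρa u))du ≤ (4C√θ/c)N ≤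
min(τ, η/8)N for θ := min(1, (c·min(τ,η/8)/4C)²), hence S = (0,s₀]; then chord(s) ≤ R′(0⁺) ≤ R′(s₀)
+ ∫₀^s₀ χ ≤ chord(s₀) + τN. A purely variational version (concavity-modulus bound 2R(s) − R(s−h) −
R(s+h) ≤ 2h²Var/Δ + o(h²) from the quadratic-form Cauchy–Schwarz, summed over a grid) avoids
derivatives. [difficulty: L] [Kato1966, ReedSimonIV1978, Griffiths1966, LiebSeiringerYngvason2005]

TWO-LAYER PLAN. Foreseen glued splits (k ≤ 3, depth 1), nothing beyond WalkGlue filed now: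
RewardChordBound ⇐ RewardScaleChord → SectorGap → CondensateVariance → RewardChordBound (glue =
WalkGlue, filed as support so the finite-N spectral bookkeeping can start and refuters can test that
the two conditional cruxes AS TYPED suffice). SectorGap ⇐ LocalMassiveGap (Bogoliubov P=0 gap on
Fournais/Junge sub-boxes ℓ ~ (ρa)^(-1/2)(ρa³)^(-η) for condensed states, where BBCS technology
works) → MassGluing (the mass √(μs) ≫ 2πc_s/L decouples boxes exponentially on the length 1/√(μs);
IMS localisation error ℓ⁻² ≪ √(μs) for s ≫ 1/(μℓ⁴)) → SectorGap; the leftover window s ≲ 1/(μℓ⁴) is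
where the crude bound has slack (∫ds/√s). CondensateVariance ⇐ PairCorrelationBound (⟨n̂₊²⟩ − ⟨n̂₊⟩²
via the two-body density of condensed near-minimisers) → CondensateVariance. RewardScaleChord ⇐
CondensedTrialState → (three-line chord estimate) → RewardScaleChord.

KILL CRITERIA. ¬SectorGap by an explicit family (a P = 0 mode below c√(ρa s) for condensed rewarded
ground states at arbitrarily small ρ, every c) kills the Gap×Variance mechanism: pivot once to a
DIRECT bound on the concavity modulus of R (2R(s) − R(s−h) − R(s+h) ≤ K N h²/√(ρa s), which
Bogoliubov predicts with room √(ρa³): χ is only log(μ/s)-divergent) restated in place of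
SectorGap/CondensateVariance; if that is refuted too, close `refuted:SectorGap`. ¬CondensateVariance
alone (Var ≫ N for condensed TL states) ⇒ same pivot. ¬RewardChordBound closes the route outright
(`refuted:RewardChordBound`) and, given RewardScaleChord, is strong evidence about PeriodicBEC
itself. ¬RewardScaleChord can only come through ¬CondensedTrialState (energy inputs are proved):
pivot to glued Dirichlet GP-boxes as the condensed trial state. ¬BoundaryTransferWeak is shared with
several open routes (BECGroundStateSOS, BECPhononFloor, BECMeanFieldControl, BECInfDivCoherence, …):
pivot to the Dirichlet-box walk with the reward on the flat mode L^(-3/2)·1_box (card TR;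
HasGroundStateBEC then follows from occupation_le_maxOccupation + le_condensateNumber, no transfer),
new decls. ¬PeriodicRigidity for hard cores only (degenerate ground states on a disconnected
hard-sphere configuration space) ⇒ restrict the line to a.e.-finite v or carry every ground-state
component (each is reached by the walk at s > 0). PeriodicBEC (stmt-0826) proved by any other route
moots ranks 2–5 (close `superseded`).

NOT DECOMPOSED YET. The finite-N spectral theory over the C¹/ℝ≥0∞ variational vocabulary (Friedrichs
realisation, compact resolvent, Perron–Frobenius with the reward kernel, analyticity of R,
Hellmann–Feynman, χ ≤ 2Var/Δ, near-minimiser ⇒ ground-state limits) lives inside the proofs of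
WalkGlue and PeriodicRigidity and is attached by provers with `--supports`; the localisation scheme
and constants (c, C, η, θ) behind SectorGap / CondensateVariance; the cluster expansion or GP-box
gluing behind CondensedTrialState; hard-core configuration-space connectivity (only PeriodicRigidity
at s = 0 needs it); T > 0 and Casimir boxes (out of scope); the Dirichlet-box variant of the walk
(reserve pivot); the a = 0 case needs no item (RewardScaleChord with θρa = 0 is RigidCondensation's
input verbatim).

CHEAPEST FALSIFIER. The exponent check of the card, run by hand at filing (gen-1 and again here): in
Bogoliubov theory with reward, e_k(s) = √((k²+s)(k²+s+2μ)), v_k² = (k²+s+μ−e_k)/(2e_k), so χ(s) =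
−dn₊/ds ≈ (L³√μ/(16√2π²))·log(μ/s) for 1/L² ≪ s ≪ μ — only LOGARITHMICALLY divergent, hence
integrable, with ∫₀^θρa χ ds = O(θ log(1/θ)·√(ρa³)N); an s⁻¹ (or worse) law would have killed the
walk and it does not occur; the crude bound 2Var/Δ ≈ 4√π√(ρa³)N/(8√π√(ρa s)) is integrable too. Next
cheapest (not run; kit job for a refuter): exact diagonalisation of H + s·n̂₊ for N ≤ 8 bosons on a
small lattice torus, comparing the concavity modulus of R(s) with 2Var/Δ_(P=0) across s ∈ [0, μ] and
checking that no P = 0 level dives below the pair threshold; and the d = 1 Lieb–Liniger control,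
where Var(n̂₀) ∝ L² must make the walk fail (it does: no BEC in d = 1).

NUMBERS. Units ħ = 2m = 1: μ = 8πρa, e_k = √(k⁴ + 16πρa k²); with reward e_k(s) =
√((k²+s)(k²+s+16πρa)); P = 0 gap 2e_(2π/L)(s) ≥ 8√π·√(ρa s) (so c = 8√π in Bogoliubov theory);
depletion n₊/N = (8/3√π)√(ρa³) ≈ 1.505√(ρa³); Var(n̂₀) ≈ Σ_k μ²/(2e_k²) = L³μ^(3/2)/(8√2π) =
2√π·√(ρa³)·N; walk budget from Gap×Var: W ≤ (4C√θ/c)N; Bogoliubov walk cost ∫₀^θρa χ =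
L³μ^(3/2)θ(log(8π/θ)+1)/(128√2π³); proved energy window: E₀^per/N ∈ [4πρa(1 − C Y^(1/17)), 4πρ₁a(1 +
12a/b)], Y = 4πρa³/3 (LiebYngvasonTheorem.lean, PeriodicBoseGasUpperBoundProofs.lean); rung-1
threshold s₀ = θρa vs Fournais2020 ℓ = C_L(ρa³)^(-δ)(ρa)^(-1/2) and Junge2026 R ~ a(ρa³)^(-3/4−η)
(dictionary s ↔ ℓ⁻²); LVZ: Δ ≥ Δ_min(β, μ) only; `closes` constants: τ = 1/8 in both rungs, c = 1 −
2·(2·1/8) = 1/2. Items at open: 12 (5 cruxes, 6 supports, 1 assembly).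

DEFINITION REQUESTS. None needed to type the route (the reward infimum R(s) is a `let` inside each
item over Literature.MathematicalPhysics.QuantumManyBody.BoseGas.{PeriodicTrialState,
periodicEnergy, condensateOccupation, periodicGroundStateEnergy, sideLength, scatteringLength, cell,
cellN, Config}). Optional hygiene later: a Literature def `rewardGroundStateEnergy v N L s := ⨅ Ψ,
periodicEnergy v Ψ + ofReal s·(N − condensateOccupation N L Ψ.ψ)` would shorten five items. No cite
facts requested: LSSY2005 Thms 2.2/2.4 and Fournais2020 Thm 1.2 are already PROVED in-tree.

Novelty: Searches (2026-08-15, this planner): `lit search --hybrid "condensate zero-mode reward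
symmetry-preserving gap Hellmann-Feynman susceptibility continuity Bose-Einstein condensation
thermodynamic limit"` (12 textbook hits: Griffin 1993/1995, Di Castro–Raimondi, El-Batanouny … — no
reward-strength continuity method); `lit galaxy search "condensate susceptibility pseudo-Goldstone
gap Bose gas" --star all` (0/0/0); `lit frontier AtomisticToContinuum --since 2023` (30 rows:
penalty/localisation devices only at strength ∝ L⁻² or on sub-thermodynamic boxes —
arXiv:2510.20493, arXiv:2603.20776, arXiv:2605.06844 trial states; nothing on a gap walk); `lit
search --source arxiv/all` on Bogoliubov spectra beyond GP (remote search unavailable this pass, rc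
75/0 rows — recorded); the 22 open routes of the sub read by title/thesis (none varies a
reward/penalty strength as a continuity parameter; BECDensityChord walks ρ at fixed N); plus the
card's ideate-15 searches and five refuter audits (8/12/14/26/36) of the same card today, which read
LVZ arXiv:math-ph/0205037 pp 5–6 and found Koma–Tasaki / Kaplan–Horsch–von der Linden as the
linear-field template.
Nearest prior art found: LauwersVerbeureZagrebnov2003 (arXiv:math-ph/0205037,
doi:10.1023/a:1023648208543) Thm 2 — BEC for superstable v given a one-particle gap Δ ≥ Δ_min,
grand-canonical T > 0, gap never removed, "gap → 0" left open in §3; VandenbergLewisPule1986 (gapped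
free part); KomaTasaki1994 / Tasaki2020 ch. 5 (linear symmetry-breaki  [refs: 10.1023/a:1023648208543, 2510.20493, 2603.20776, 2605.06844, math-ph/0205037, doi:10.1023/a, LauwersVerbeureZagrebnov2003, VandenbergLewisPule1986, KomaTasaki1994, Tasaki2020, Fournais2020, FournaisEtAl2024, Junge2026]

Barriers (technique_class: continuity-method, hellmann-feynman, pseudo-goldstone-gap): - technique_class: continuity-method, hellmann-feynman, pseudo-goldstone-gap
- Literature.Barriers.AtomisticToContinuum.KineticGapLengthScales: RewardScaleChord sits INSIDE the
energy-window class on purpose (a reward ≥ θρa is what two-sided energy bounds can certify, exactly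
as ℓ⁻² ≥ ρa(ρa³)^η is for boxes); the walk LEAVES the class — it uses the response of the ground
state (R″, sector gaps, Var n̂₀), which the entry lists as not covered; no L² is ever paid because
the reward, not the box, supplies the gap.
- Literature.Barriers.AtomisticToContinuum.KineticGapLengthScalesNarrow: the Galilei-boost witness
(decondensed states inside the kinetic gap) costs sN ≫ 4π²N/L² under a FIXED reward s = θρa, so it
does not touch RewardScaleChord; it is why the reward may not scale like L⁻² (cf.
BECPinning.PhaseTwistObstruction) and why the walk is never continued to s < −4π²/L².
- Literature.Barriers.AtomisticToContinuum.EnergyAsymptoticsWithoutCondensation: respected — energy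
asymptotics buy condensation only at s ≥ θρa (rung 1), never at s = 0; the s = 0 statement comes
from spectral/response input (SectorGap, CondensateVariance), and the 1-D witness defeats the walk
through Var(n̂₀) ∝ L², as it must.
- Literature.Barriers.AtomisticToContinuum.EnergyAsymptoticsWithoutCondensationNarrow: same; only
leading-order energy input is used, and only for the rewarded Hamiltonian.
- Literature.Barriers.AtomisticToContinuum.BogoliubovPerturbationInfrared:
SectorGap/CondensateVariance are asked

History (route lifecycle, newest last):
- 2026-08-25T12:43:40Z · DORMANT — reconciler: no traction for 7.7 d (last activity item-evidence-added at 2026-08-17T19:14:46Z); parked, not closed — `ledger route dormant route-AtomisticToConti (operator:999:26942)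
- 2026-08-29T03:27:01Z · REACTIVATED — reconciler: reactivated — activity statement-checked at 2026-08-29T01:17:37Z after parking at 2026-08-25T12:43:40Z (operator:999:178942)

sub-problem: BoseEinsteinCondensation · status: open · opened planner-plancard-AtomisticToContinuum-BoseEin-029214b9-g2-0 2026-08-15T18:56:38Z · rev 1 · ledger route-AtomisticToContinuum-BECRewardDescent
GENERATED by the gate from the ledger (D-0016/17). Provers cite these decls: `theorem foo : Summit.AtomisticToContinuum.BoseEinsteinCondensation.Theses.BECRewardDescent.<Decl> := …` in Summits/AtomisticToContinuum/BoseEinsteinCondensation/Theorems/<Name>.lean.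
-/

namespace Summit.AtomisticToContinuum.BoseEinsteinCondensation.Theses.BECRewardDescent

open scoped BigOperators Topology Manifold Classical MeasureTheory ProbabilityTheory Matrix InnerProductSpace ComplexConjugate ContinuousMap
open Filter Set Function TopologicalSpace MeasureTheory

attribute [summit_statement] _root_.BoseEinsteinCondensation

/-- item stmt-AtomisticToContinuum-12874 · crux · rank 2 · open · by planner
why it might fail: Bogoliubov's P=0 gap is proved only in GP/GP+κ boxes (BoccatoEtAl2019Acta, BrenneckeCaporalettiSchlein2022); at L=(N/ρ)^(1/3) there are N√(ρa³) excitations, cubic/quartic terms are not norm-small, and a soft collective P=0 mode below c√(ρa s) would refute c uniform in N.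
sources: BoccatoEtAl2019Acta, BrenneckeCaporalettiSchlein2022, BrenneckeEtAl2024, DerezinskiNapiorkowski2014, Seiringer2011, ChongLiangNam2026
[crux] (card BOOT(a)/FIN(a), merged) for every repulsive finite-range v there are η, c, ρ₀ > 0 such
that for 0 < ρ < ρ₀, all large N (L = (N/ρ)^(1/3), a = scattering length) and every reward 0 < s ≤
ρa: IF the near-minimisers of F_s are (1−η)-condensed (∃δ>0: F_s(Ψ) ≤ R(s)+δ ⇒ n₀(Ψ) ≥ (1−η)N) THEN
the zero-total-momentum sector has spectral gap ≥ c√(ρa)√s above R(s), in Ky-Fan form: F_s(Φ₁) +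
F_s(Φ₂) ≥ 2R(s) + c√(ρa s) for every pair of L²(cell^N)-orthogonal periodic trial states invariant
under simultaneous translation of all particles. Bogoliubov value: pair energy
2√((4π²/L²+s)(4π²/L²+s+16πρa)) ≥ 8√π·√(ρa s), i.e. c = 8√π. [difficulty: open-problem] -/
@[route_item "route-AtomisticToContinuum-BECRewardDescent", crux]
def SectorGap : Prop :=
  ∀ v : ℝ → ENNReal, Literature.MathematicalPhysics.QuantumManyBody.BoseGas.IsRepulsiveFiniteRange v → ∃ η c ρ₀ : ℝ, 0 < η ∧ 0 < c ∧ 0 < ρ₀ ∧ ∀ ρ : ℝ, 0 < ρ → ρ < ρ₀ → ∀ᶠ N : ℕ in Filter.atTop, ∀ s : ℝ, 0 < s → s ≤ ρ * (Literature.MathematicalPhysics.QuantumManyBody.BoseGas.scatteringLength v).toReal → let L : ℝ := Literature.MathematicalPhysics.QuantumManyBody.BoseGas.sideLength ρ N; let F : Literature.MathematicalPhysics.QuantumManyBody.BoseGas.PeriodicTrialState N L → ENNReal := fun Ψ => Literature.MathematicalPhysics.QuantumManyBody.BoseGas.periodicEnergy v Ψ + ENNReal.ofReal s * ((N : ENNReal)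 - Literature.MathematicalPhysics.QuantumManyBody.BoseGas.condensateOccupation N L Ψ.ψ); (∃ δ : ENNReal, 0 < δ ∧ ∀ Ψ : Literature.MathematicalPhysics.QuantumManyBody.BoseGas.PeriodicTrialState N L, F Ψ ≤ (⨅ Ψ', F Ψ') + δ → ENNReal.ofReal ((1 - η) * N) ≤ Literature.MathematicalPhysics.QuantumManyBody.BoseGas.condensateOccupation N L Ψ.ψ) → ∀ Φ₁ Φ₂ : Literature.MathematicalPhysics.QuantumManyBody.BoseGas.PeriodicTrialState N L, (∀ (X : Literature.MathematicalPhysics.QuantumManyBody.BoseGas.Config N) (t : EuclideanSpace ℝ (Fin 3)), Φ₁.ψ (fun i => X i + t) = Φ₁.ψ X) → (∀ (X : Literature.MathematicalPhysics.QuantumManyBody.BoseGas.Config N) (t : EuclideanSpace ℝ (Fin 3)), Φ₂.ψ (fun i => X i + t) = Φ₂.ψ X) → (∫ X in Literature.MathematicalPhysics.QuantumManyBody.BoseGas.cellN N L, starRingEnd ℂ (Φ₁.ψ X) * Φ₂.ψ X) = 0 → 2 * (⨅ Ψ', F Ψ') + ENNReal.ofReal (c * Real.sqrt (ρ * (Literature.MathematicalPhysics.QuantumManyBody.BoseGas.scatteringLength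 v).toReal) * Real.sqrt s) ≤ F Φ₁ + F Φ₂

/-- item stmt-AtomisticToContinuum-12875 · crux · rank 3 · open · by planner
why it might fail: Needs a 4-point bound for condensed states at L=(N/ρ)^(1/3), quartic in excitation operators — exactly where TL Bogoliubov control is missing; anomalous fluctuations Var(n̂₀) ≫ N (GiorginiPitaevskiiStringari1998 find N^(4/3) canonically at T>0) would break the walk.
sources: LiebSeiringerYngvason2005, BoccatoEtAl2019Acta, GiorginiPitaevskiiStringari1998, BrenneckeCaporalettiSchlein2022, LSSY2005
[crux] (card BOOT(b)/FIN(b)) for every repulsive finite-range v there are η, C, ρ₀ > 0 such that for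
0 < ρ < ρ₀, all large N and every 0 < s ≤ ρa: IF the near-minimisers of F_s are (1−η)-condensed THEN
for some δ > 0 every δ-near-minimiser Ψ of F_s has ⟨Ψ, n̂₀²Ψ⟩ ≤ ⟨Ψ,n̂₀Ψ⟩² + C·N, i.e. Var_Ψ(n̂₀) ≤
CN, where ⟨Ψ,n̂₀²Ψ⟩ = ‖Σ_i P_iΨ‖² = L⁻⁶∫_(cell^N)|Σ_i∫_cell Ψ(X[i↦y])dy|²dX. Bogoliubov value at T =
0: Var(n̂₀) = Σ_k 2u_k²v_k² ≈ 2√π·√(ρa³)·N, infrared-finite (∫d³k/k²) exactly in d = 3. [difficulty: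
XL] -/
@[route_item "route-AtomisticToContinuum-BECRewardDescent", crux]
def CondensateVariance : Prop :=
  ∀ v : ℝ → ENNReal, Literature.MathematicalPhysics.QuantumManyBody.BoseGas.IsRepulsiveFiniteRange v → ∃ η C ρ₀ : ℝ, 0 < η ∧ 0 < C ∧ 0 < ρ₀ ∧ ∀ ρ : ℝ, 0 < ρ → ρ < ρ₀ → ∀ᶠ N : ℕ in Filter.atTop, ∀ s : ℝ, 0 < s → s ≤ ρ * (Literature.MathematicalPhysics.QuantumManyBody.BoseGas.scatteringLength v).toReal → let L : ℝ := Literature.MathematicalPhysics.QuantumManyBody.BoseGas.sideLength ρ N; let F : Literature.MathematicalPhysics.QuantumManyBody.BoseGas.PeriodicTrialState N L → ENNReal := fun Ψ => Literature.MathematicalPhysics.QuantumManyBody.BoseGas.periodicEnergy v Ψ + ENNReal.ofReal s * ((N : ENNReal) - Literature.MathematicalPhysics.QuantumManyBody.BoseGas.condensateOccupation N L Ψ.ψ); (∃ δ : ENNReal, 0 < δ ∧ ∀ Ψ : Literature.MathematicalPhysics.QuantumManyBody.BoseGas.PeriodicTrialState N L, F Ψ ≤ (⨅ Ψ', F Ψ')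 + δ → ENNReal.ofReal ((1 - η) * N) ≤ Literature.MathematicalPhysics.QuantumManyBody.BoseGas.condensateOccupation N L Ψ.ψ) → ∃ δ : ENNReal, 0 < δ ∧ ∀ Ψ : Literature.MathematicalPhysics.QuantumManyBody.BoseGas.PeriodicTrialState N L, F Ψ ≤ (⨅ Ψ', F Ψ') + δ → ENNReal.ofReal ((L ^ 3)⁻¹ ^ 2) * (∫⁻ X in Literature.MathematicalPhysics.QuantumManyBody.BoseGas.cellN N L, (‖∑ i : Fin N, ∫ y in Literature.MathematicalPhysics.QuantumManyBody.BoseGas.cell L, Ψ.ψ (Function.update X i y)‖₊ : ENNReal) ^ 2) ≤ Literature.MathematicalPhysics.QuantumManyBody.BoseGas.condensateOccupation N L Ψ.ψ ^ 2 + ENNReal.ofReal (C * N)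

/-- item stmt-AtomisticToContinuum-12876 · crux · rank 4 · open · by planner
why it might fail: Unconditional TL statement: with RewardScaleChord and rigidity it yields torus BEC, so off the WalkGlue path it is as hard as PeriodicBEC; false iff removing a reward ≤ θμ/8π moves the ground-state depletion by ≥ τN at arbitrarily small ρ (non-integrable χ, as in d ≤ 2).
sources: LauwersVerbeureZagrebnov2003, Kato1966, Griffiths1966, LiebSeiringerYngvason2005, LSSY2005
[crux] (card WALK/RUNG 2, output form) for every repulsive finite-range v and every τ > 0 there are
θ, ρ₀ > 0 such that for 0 < ρ < ρ₀ and all large N: for all 0 < s ≤ s₀ := θρa, chord(s) ≤ chord(s₀)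
+ τN, written subtraction-free as R(s) + (s/s₀)E₀^per ≤ E₀^per + (s/s₀)R(s₀) + sτN. Equivalently
R′(0⁺) − R′(s₀⁻) = ∫₀^s₀ χ(s)ds ≤ τN: removing a reward of strength ≤ θμ/8π changes the ground-state
depletion by at most τN (Bogoliubov: by O(√(ρa³)N·θ log(1/θ))). Vacuous when a = 0. [deps:
RewardScaleChord, SectorGap, CondensateVariance, WalkGlue] [difficulty: open-problem] -/
@[route_item "route-AtomisticToContinuum-BECRewardDescent", crux]
def RewardChordBound : Prop :=
  ∀ v : ℝ → ENNReal, Literature.MathematicalPhysics.QuantumManyBody.BoseGas.IsRepulsiveFiniteRange v → ∀ τ : ℝ, 0 < τ → ∃ θ ρ₀ : ℝ, 0 < θ ∧ 0 < ρ₀ ∧ ∀ ρ : ℝ, 0 < ρ → ρ < ρ₀ → ∀ᶠ N : ℕ in Filter.atTop, ∀ s : ℝ, 0 < s → s ≤ θ * ρ * (Literature.MathematicalPhysics.QuantumManyBody.BoseGas.scatteringLength v).toReal → let L : ℝ := Literature.MathematicalPhysics.QuantumManyBody.BoseGas.sideLength ρ N; let s₀ : ℝ := θ * ρ * (Literature.MathematicalPhysics.QuantumManyBody.BoseGas.scatteringLength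 v).toReal; let R : ℝ → ENNReal := fun t => ⨅ Ψ : Literature.MathematicalPhysics.QuantumManyBody.BoseGas.PeriodicTrialState N L, (Literature.MathematicalPhysics.QuantumManyBody.BoseGas.periodicEnergy v Ψ + ENNReal.ofReal t * ((N : ENNReal) - Literature.MathematicalPhysics.QuantumManyBody.BoseGas.condensateOccupation N L Ψ.ψ)); R s + ENNReal.ofReal (s / s₀) * Literature.MathematicalPhysics.QuantumManyBody.BoseGas.periodicGroundStateEnergy v N L ≤ Literature.MathematicalPhysics.QuantumManyBody.BoseGas.periodicGroundStateEnergy v N L + ENNReal.ofReal (s / s₀) * R s₀ + ENNReal.ofReal (s * τ * N)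

/-- item stmt-AtomisticToContinuum-12877 · crux · rank 5 · closed · proved by Summit.AtomisticToContinuum.BoseEinsteinCondensation.Theorems.rewardScaleChord_proof @ 3a4f690cc629 (prover) · by planner
why it might fail: Energy inputs are PROVED in-tree (LSSY Thms 2.2/2.4), but the rung needs a CONDENSED near-optimal C¹ periodic trial state at L=(N/ρ)^(1/3) (CondensedTrialState: Jastrow 1-pdm by cluster expansion, or glued GP boxes; hard cores need C¹ profiles) — not in print as stated.
sources: LSSY2005, LiebYngvason1998, LauwersVerbeureZagrebnov2003, Fournais2020, FournaisEtAl2024, Junge2026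
[crux] (card RS/RUNG 1, chord form) for every repulsive finite-range v and all τ, θ > 0 there is ρ₀
> 0 such that for 0 < ρ < ρ₀, all large N (L = (N/ρ)^(1/3)) and every s ≥ θρ·a, s > 0: R(s) ≤
E₀^per(N,L) + sτN; consequently every δ-near-minimiser of F_s has depletion ≤ τN + δ/s —
thermodynamic-limit condensation of the REWARDED torus gas at a price s with s/μ = θ/8π arbitrarily
small. Proof route: R(s) ≤ F_s(Φ) ≤ 4πaρ(1+η)N + sηN for the condensed trial state Φ of
CondensedTrialState, and E₀^per ≥ 4πρa(1 − C Y^(1/17))N by the PROVED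
LSSY2005_lowerBound_periodic_holds; choose η ≤ min(τ/2, θτ/16π) and C Y^(1/17) ≤ θτ/16π. At a = 0 (v
= 0 a.e.) it holds for all s > 0 with Φ = constant. [deps: CondensedTrialState,
ScatteringLengthFinite] [difficulty: M] -/
@[route_item "route-AtomisticToContinuum-BECRewardDescent", crux]
def RewardScaleChord : Prop :=
  ∀ v : ℝ → ENNReal, Literature.MathematicalPhysics.QuantumManyBody.BoseGas.IsRepulsiveFiniteRange v → ∀ τ θ : ℝ, 0 < τ → 0 < θ → ∃ ρ₀ : ℝ, 0 < ρ₀ ∧ ∀ ρ : ℝ, 0 < ρ → ρ < ρ₀ → ∀ᶠ N : ℕ in Filter.atTop, ∀ s : ℝ, 0 < s → θ * ρ * (Literature.MathematicalPhysics.QuantumManyBody.BoseGas.scatteringLength v).toReal ≤ s → let L : ℝ := Literature.MathematicalPhysics.QuantumManyBody.BoseGas.sideLength ρ N; (⨅ Ψ : Literature.MathematicalPhysics.QuantumManyBody.BoseGas.PeriodicTrialState N L, (Literature.MathematicalPhysics.QuantumManyBody.BoseGas.periodicEnergy v Ψ + ENNReal.ofReal s * ((N : ENNReal) - Literature.MathematicalPhysics.QuantumManyBody.BoseGas.condensateOccupation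 N L Ψ.ψ))) ≤ Literature.MathematicalPhysics.QuantumManyBody.BoseGas.periodicGroundStateEnergy v N L + ENNReal.ofReal (s * τ * N)

-- `RewardScaleChord` holds: proved by `Summit.AtomisticToContinuum.BoseEinsteinCondensation.Theorems.rewardScaleChord_proof` @ 3a4f690cc629 (its module imports this route file, so no `_holds` link can be stated here).

/-- item stmt-AtomisticToContinuum-0827 · crux · rank 6 · open · by planner
why it might fail: PeriodicBEC(v) is ground-state-only (δ after N) at the box (N/ρ)^(1/3): the Dirichlet GS is not a periodic near-minimiser (wall term ≫ δ), interior restrictions are neither periodic nor of sharp N, so the hypothesis may never fire (transfer ≈ conjunct); BEC is BC-sensitive (Robinson1976).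
sources: LiebSeiringerSolovejYngvason2005, Basti2022, BoccatoSeiringer2023, Junge2026, Robinson1976, LauwersVerbeureZagrebnov2003
[crux] BoundaryTransferWeak (mode-free boundary-condition transfer, per potential): for each
repulsive finite-range v, PeriodicBEC(v) implies ∃ρ₀>0 ∀ρ∈(0,ρ₀) HasGroundStateBEC v ρ (Dirichlet
ground state, λ_max(γ) ≥ cN via condensateNumber). Not glue: near-minimiser slacks are O(N/L²) while
Dirichlet/periodic energies differ by a boundary term ≫ N/L², so no energy-comparison proof;
expected route: Neumann bracketing of interior sub-boxes (−Δ_Dir ≥ ⊕−Δ_Neu, v ≥ 0) + a mode-free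
criterion (λ_max ≥ tr γ²/N). Only the ENERGY analogue is in print (LiebSeiringerSolovejYngvason2005
Ch. 2 after (2.8)). v ≡ 0: hypothesis and conclusion both true. -/
@[route_item "route-AtomisticToContinuum-BECRewardDescent", crux]
def BoundaryTransferWeak : Prop :=
  ∀ v : ℝ → ENNReal, Literature.MathematicalPhysics.QuantumManyBody.BoseGas.IsRepulsiveFiniteRange v → (∃ ρ₀ : ℝ, 0 < ρ₀ ∧ ∀ ρ : ℝ, 0 < ρ → ρ < ρ₀ → ∃ c : ℝ, 0 < c ∧ ∀ᶠ N : ℕ in Filter.atTop, ∃ δ : ENNReal, 0 < δ ∧ ∀ Ψ : Literature.MathematicalPhysics.QuantumManyBody.BoseGas.PeriodicTrialState N (Literature.MathematicalPhysics.QuantumManyBody.BoseGas.sideLength ρ N), Literature.MathematicalPhysics.QuantumManyBody.BoseGas.periodicEnergy v Ψ ≤ Literature.MathematicalPhysics.QuantumManyBody.BoseGas.periodicGroundStateEnergy v N (Literature.MathematicalPhysics.QuantumManyBody.BoseGas.sideLength ρ N) + δ → ENNReal.ofReal (c * N) ≤ Literature.MathematicalPhysics.QuantumManyBody.BoseGas.condensateOccupation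 N (Literature.MathematicalPhysics.QuantumManyBody.BoseGas.sideLength ρ N) Ψ.ψ) → ∃ ρ₀ : ℝ, 0 < ρ₀ ∧ ∀ ρ : ℝ, 0 < ρ → ρ < ρ₀ → Literature.MathematicalPhysics.QuantumManyBody.BoseGas.HasGroundStateBEC v ρ

/-- item stmt-AtomisticToContinuum-12878 · support · rank 9 · closed · proved by Summit.AtomisticToContinuum.BoseEinsteinCondensation.Theorems.rigidCondensation_proof (prover) · by planner
sources: ReedSimonIV1978, LSSY2005, Fournais2020
[support] (new, deterministic at each (v, ρ, N, τ); the step `closes` consumes) if E₀^per(N,L) < ∞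
(L = (N/ρ)^(1/3)), the rigidity body of PeriodicRigidity holds at (ρ, N), and R(s) ≤ E₀^per + sτN
for all s in some interval (0, s₁], then for some δ > 0 every δ-near-minimiser Ψ of the periodic
energy has n₀(Ψ) ≥ (1 − 2τ)N. Proof (provable now): pick s ≤ s₁ and an ε-minimiser Φ of F_s with ε =
sτN/2; then periodicEnergy Φ ≤ E₀ + (3/2)sτN =: E₀ + δ′ and N − n₀(Φ) ≤ (3/2)τN; by rigidity (η with
2√η ≤ τ/2) every δ′-near-minimiser Ψ is L²(cell^N)-close to cΦ, and √(n₀(·)/N) = ‖AΨ‖ with (AΨ)(Y) =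
⟨φ₀, Ψ(·,Y)⟩, ‖A‖ ≤ 1, is 1-Lipschitz, so n₀(Ψ)/N ≥ (√(1 − 3τ/2) − √η)² ≥ 1 − 2τ (trivial for τ ≥
1/2; N = 0 fine). In-tree slice lemmas: condensateOccupation_succ, lintegral_cellN_succ,
measurePreserving_vecCons. [difficulty: provable-now] -/
@[route_item "route-AtomisticToContinuum-BECRewardDescent", crux]
def RigidCondensation : Prop :=
  ∀ (v : ℝ → ENNReal) (ρ : ℝ) (N : ℕ) (τ : ℝ), 0 < τ → let L : ℝ := Literature.MathematicalPhysics.QuantumManyBody.BoseGas.sideLength ρ N; let R : ℝ → ENNReal := fun t => ⨅ Ψ : Literature.MathematicalPhysics.QuantumManyBody.BoseGas.PeriodicTrialState N L, (Literature.MathematicalPhysics.QuantumManyBody.BoseGas.periodicEnergy v Ψ + ENNReal.ofReal t * ((N : ENNReal) - Literature.MathematicalPhysics.QuantumManyBody.BoseGas.condensateOccupation N L Ψ.ψ)); Literature.MathematicalPhysics.QuantumManyBody.BoseGas.periodicGroundStateEnergy v N L ≠ ⊤ → (∀ η : ℝ, 0 < η → ∃ δ : ENNReal, 0 < δ ∧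 ∀ Ψ Φ : Literature.MathematicalPhysics.QuantumManyBody.BoseGas.PeriodicTrialState N L, Literature.MathematicalPhysics.QuantumManyBody.BoseGas.periodicEnergy v Ψ ≤ Literature.MathematicalPhysics.QuantumManyBody.BoseGas.periodicGroundStateEnergy v N L + δ → Literature.MathematicalPhysics.QuantumManyBody.BoseGas.periodicEnergy v Φ ≤ Literature.MathematicalPhysics.QuantumManyBody.BoseGas.periodicGroundStateEnergy v N L + δ → ∃ c : ℂ, ‖c‖ = 1 ∧ ∫⁻ X in Literature.MathematicalPhysics.QuantumManyBody.BoseGas.cellN N L, (‖Ψ.ψ X - c * Φ.ψ X‖₊ : ENNReal) ^ 2 ≤ ENNReal.ofReal η) → (∃ s₁ : ℝ, 0 < s₁ ∧ ∀ s : ℝ, 0 < s → s ≤ s₁ → R s ≤ Literature.MathematicalPhysics.QuantumManyBody.BoseGas.periodicGroundStateEnergy v N L + ENNReal.ofReal (s * τ * N)) → ∃ δ : ENNReal, 0 < δ ∧ ∀ Ψ : Literature.MathematicalPhysics.QuantumManyBody.BoseGas.PeriodicTrialState N L, Literature.MathematicalPhysics.QuantumManyBody.BoseGas.periodicEnergy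 v Ψ ≤ Literature.MathematicalPhysics.QuantumManyBody.BoseGas.periodicGroundStateEnergy v N L + δ → ENNReal.ofReal ((1 - 2 * τ) * N) ≤ Literature.MathematicalPhysics.QuantumManyBody.BoseGas.condensateOccupation N L Ψ.ψ

-- `RigidCondensation` holds: proved by `Summit.AtomisticToContinuum.BoseEinsteinCondensation.Theorems.rigidCondensation_proof` (its module imports this route file, so no `_holds` link can be stated here).

/-- item stmt-AtomisticToContinuum-12879 · support · rank 9 · closed · proved by Summit.AtomisticToContinuum.BoseEinsteinCondensation.Theorems.condensedTrialState_proof @ 57680d0b1f05 (prover) · by planner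
sources: LSSY2005, LiebSeiringer2002, PenroseOnsager1956, PulvirentiTsagkarogiannis2012, Ueltschi2006, arXiv:2605.06844
[support] for every repulsive finite-range v and η > 0, at small density and for all large N there
is a periodic C¹ Bose-symmetric normalised trial state Φ on the torus of side (N/ρ)^(1/3) with
periodicEnergy ≤ 4πaρ(1+η)N AND condensateOccupation ≥ (1−η)N. Candidates: (i) the in-tree
Jastrow/Dyson product `IsPairProfile.trialState` (Π f(x_i−x_j), f = 1 beyond b, a/η ≲ b ≪ ρ^(-1/3))
whose energy is the proof of LSSY2005 Thm 2.2 and whose one-particle density matrix is a two-ghost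
insertion ratio of canonical partition functions of the classical gas with pair weight f²
(Penrose–Onsager), controlled by a convergent cluster expansion in ρ∫(1−f²) ~ ρab²; (ii) symmetrised
products of Dirichlet GP-box ground states (box side √(g/ρa), g = g(η) large, complete BEC in the GP
limit LiebSeiringer2002 / LSSY2005 Thm 7.1) glued with corridors; a = 0: Φ = constant. [difficulty:
L] -/
@[route_item "route-AtomisticToContinuum-BECRewardDescent"]
def CondensedTrialState : Prop :=
  ∀ v : ℝ → ENNReal, Literature.MathematicalPhysics.QuantumManyBody.BoseGas.IsRepulsiveFiniteRange v → ∀ η : ℝ, 0 < η → ∃ ρ₀ : ℝ, 0 < ρ₀ ∧ ∀ ρ : ℝ, 0 < ρ → ρ < ρ₀ → ∀ᶠ N : ℕ in Filter.atTop, let L : ℝ := Literature.MathematicalPhysics.QuantumManyBody.BoseGas.sideLength ρ N; ∃ Φ : Literature.MathematicalPhysics.QuantumManyBody.BoseGas.PeriodicTrialState N L, Literature.MathematicalPhysics.QuantumManyBody.BoseGas.periodicEnergy v Φ ≤ ENNReal.ofReal (4 * Real.pi * (Literature.MathematicalPhysics.QuantumManyBody.BoseGas.scatteringLength v).toReal *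 ρ * (1 + η) * N) ∧ ENNReal.ofReal ((1 - η) * N) ≤ Literature.MathematicalPhysics.QuantumManyBody.BoseGas.condensateOccupation N L Φ.ψ

-- `CondensedTrialState` holds: proved by `Summit.AtomisticToContinuum.BoseEinsteinCondensation.Theorems.condensedTrialState_proof` @ 57680d0b1f05 (its module imports this route file, so no `_holds` link can be stated here).

/-- item stmt-AtomisticToContinuum-12880 · support · rank 9 · closed · proved by Summit.AtomisticToContinuum.BoseEinsteinCondensation.Theorems.walkGlue_proof @ 1a384066e598 (prover) · by planner
sources: Kato1966, ReedSimonIV1978, Griffiths1966, LiebSeiringerYngvason2005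
[support] (glue of the foreseen split RewardChordBound ⇐ RewardScaleChord, SectorGap,
CondensateVariance; kind glue, filed as support) RewardScaleChord → SectorGap → CondensateVariance →
RewardChordBound. Content, at fixed (N,L): for every s > 0, H + s·n̂₊ has a unique, positive,
translation-invariant ground state Ψ_s (e^(ts n̂₀) ≥ (ts)^N L^(−3N) has a strictly positive kernel,
e^(−tH) preserves positivity even with hard cores), so R is concave and real-analytic on (0,∞) with
R′(s) = n₊(Ψ_s) and −R″(s) = 2Σ_m|⟨m|n̂₀|Ψ_s⟩|²/(E_m−E₀) ≤ 2Var_(Ψ_s)(n̂₀)/Δ_(P=0)(s) (Kato; Ky-Fan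
gap from SectorGap; δ-near-minimisers of F_s converge to Ψ_s, so the cruxes' hypotheses at s follow
from n₊(Ψ_s) ≤ ηN/2); bootstrap: S = {s ∈ (0,s₀] : n₊(Ψ_u) ≤ ηN/2 on [s,s₀]} is closed, and open by
RewardScaleChord(η/4, θ) (n₊(Ψ_s₀) ≤ chord(s₀) ≤ ηN/4) plus ∫_s^s₀ 2CN/(c√(ρa u))du ≤ (4C√θ/c)N ≤
min(τ, η/8)N for θ := min(1, (c·min(τ,η/8)/4C)²), hence S = (0,s₀]; then chord(s) ≤ R′(0⁺) ≤ R′(s₀)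
+ ∫₀^s₀ χ ≤ chord(s₀) + τN. A purely variational version (concavity-modulus bound 2R(s) − R(s−h) −
R(s+h) ≤ 2h²Var/Δ + o(h²) from the quadratic-form Cauchy–Schwarz, summed over a grid) avoids
derivatives. [difficulty: L] -/
@[route_item "route-AtomisticToContinuum-BECRewardDescent"]
def WalkGlue : Prop :=
  RewardScaleChord → SectorGap → CondensateVariance → RewardChordBound

-- `WalkGlue` holds: proved by `Summit.AtomisticToContinuum.BoseEinsteinCondensation.Theorems.walkGlue_proof` @ 1a384066e598 (its module imports this route file, so no `_holds` link can be stated here).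

/-- item stmt-AtomisticToContinuum-3974 · support · rank 9 · closed · proved by Summit.AtomisticToContinuum.BoseEinsteinCondensation.Theorems.periodicEnergyFinite_proof (prover) · by planner
sources: LSSY2005
[support] FINITENESS: for repulsive finite-range v (range R₀) there is ρ₀ > 0 with E₀^per(N,
(N/ρ)^{1/3}) < ⊤ for ρ < ρ₀ and all large N (N bumps at mutual torus distance > R₀; or directly from
LSSY2005_upperBound_periodic_holds once scatteringLength v ≠ ⊤, cf. stmt-AtomisticToContinuum-0851).
Needed to subtract in ℝ≥0∞ and to make the near-minimiser hypotheses non-vacuous. [difficulty: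
provable-now] -/
@[route_item "route-AtomisticToContinuum-BECRewardDescent", crux]
def PeriodicEnergyFinite : Prop :=
  ∀ v : ℝ → ENNReal, Literature.MathematicalPhysics.QuantumManyBody.BoseGas.IsRepulsiveFiniteRange v → ∃ ρ₀ : ℝ, 0 < ρ₀ ∧ ∀ ρ : ℝ, 0 < ρ → ρ < ρ₀ → ∀ᶠ N : ℕ in Filter.atTop, Literature.MathematicalPhysics.QuantumManyBody.BoseGas.periodicGroundStateEnergy v N (Literature.MathematicalPhysics.QuantumManyBody.BoseGas.sideLength ρ N) ≠ ⊤

/-- `PeriodicEnergyFinite` holds: proved by `Summit.AtomisticToContinuum.BoseEinsteinCondensation.Theorems.periodicEnergyFinite_proof`. -/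
theorem PeriodicEnergyFinite_holds : PeriodicEnergyFinite := _root_.Summit.AtomisticToContinuum.BoseEinsteinCondensation.Theorems.periodicEnergyFinite_proof

/-- item stmt-AtomisticToContinuum-8958 · support · rank 9 · open · by planner
sources: ReedSimonIV1978, Kato1966, BaryshnikovBubenikKahle2013, DiaconisLebeauMichel2010, LSSY2005
[crux] (card item PI4, torus twin of BECPalmLandscape.GroundStateRigidity =
stmt-AtomisticToContinuum-3298) ∀ admissible v ∃ρ₀ ∀ρ<ρ₀ ∀ᶠ N ∀η>0 ∃δ>0: any two periodic
δ-near-minimisers Ψ, Φ ∈ PeriodicTrialState N L (L = (N/ρ)^{1/3}) satisfy ∫_{cell^N}|Ψ − cΦ|² ≤ η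
for some unit complex c (E₀^per < ∞ at low density, compact resolvent of the torus N-body operator,
unique positive ground state by positivity improvement, spectral gap at fixed N; hard cores via
energetic dominance / connectivity of the dilute component of configuration space). [difficulty: M] -/
@[route_item "route-AtomisticToContinuum-BECRewardDescent", crux]
def PeriodicRigidity : Prop :=
  ∀ v : ℝ → ENNReal, Literature.MathematicalPhysics.QuantumManyBody.BoseGas.IsRepulsiveFiniteRange v → ∃ ρ₀ : ℝ, 0 < ρ₀ ∧ ∀ ρ : ℝ, 0 < ρ → ρ < ρ₀ → ∀ᶠ N : ℕ in Filter.atTop, ∀ η : ℝ, 0 < η → ∃ δ : ENNReal, 0 < δ ∧ ∀ Ψ Φ : Literature.MathematicalPhysics.QuantumManyBody.BoseGas.PeriodicTrialState N (Literature.MathematicalPhysics.QuantumManyBody.BoseGas.sideLength ρ N), Literature.MathematicalPhysics.QuantumManyBody.BoseGas.periodicEnergy v Ψ ≤ Literature.MathematicalPhysics.QuantumManyBody.BoseGas.periodicGroundStateEnergy v N (Literature.MathematicalPhysics.QuantumManyBody.BoseGas.sideLength ρ N) + δ → Literature.MathematicalPhysics.QuantumManyBody.BoseGas.periodicEnergy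 v Φ ≤ Literature.MathematicalPhysics.QuantumManyBody.BoseGas.periodicGroundStateEnergy v N (Literature.MathematicalPhysics.QuantumManyBody.BoseGas.sideLength ρ N) + δ → ∃ c : ℂ, ‖c‖ = 1 ∧ ∫⁻ X in Literature.MathematicalPhysics.QuantumManyBody.BoseGas.cellN N (Literature.MathematicalPhysics.QuantumManyBody.BoseGas.sideLength ρ N), (‖Ψ.ψ X - c * Φ.ψ X‖₊ : ENNReal) ^ 2 ≤ ENNReal.ofReal η

/-- item stmt-AtomisticToContinuum-9006 · support · rank 9 · closed · proved by Summit.AtomisticToContinuum.BoseEinsteinCondensation.Theorems.scatteringLengthFinite_proof @ a500d4b93471 (prover) · by planner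
sources: LSSY2005
[support] (shared verbatim with route EqualScatteringTransfer, stmt-AtomisticToContinuum-0851)
finite range ⇒ scatteringLength v ≠ ⊤ (a ≤ R₀ + ε by the C¹ trial φ = 0 on B_{R₀}, = 1 off B_{R₀+ε};
hard cores included since ⊤·0 = 0). Discharges the `≠ ⊤` hypothesis of the cruxes in the glue.
[difficulty: provable-now] -/
@[route_item "route-AtomisticToContinuum-BECRewardDescent"]
def ScatteringLengthFinite : Prop :=
  ∀ v : ℝ → ENNReal, Literature.MathematicalPhysics.QuantumManyBody.BoseGas.IsRepulsiveFiniteRange v → Literature.MathematicalPhysics.QuantumManyBody.BoseGas.scatteringLength v ≠ ⊤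

/-- `ScatteringLengthFinite` holds: proved by `Summit.AtomisticToContinuum.BoseEinsteinCondensation.Theorems.scatteringLengthFinite_proof` @ a500d4b93471. -/
theorem ScatteringLengthFinite_holds : ScatteringLengthFinite := _root_.Summit.AtomisticToContinuum.BoseEinsteinCondensation.Theorems.scatteringLengthFinite_proof

/-- item stmt-AtomisticToContinuum-12881 · assembly · rank 1 · closed · proved by Summit.AtomisticToContinuum.BoseEinsteinCondensation.Theorems.becRewardDescent_assembly_proof (prover) · by planner
sources: LSSY2005, LauwersVerbeureZagrebnov2003
[assembly] RewardScaleChord → RewardChordBound → PeriodicEnergyFinite → PeriodicRigidity →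
RigidCondensation → BoundaryTransferWeak → BoseEinsteinCondensation (the type of the proved
`closes`). -/
@[route_item "route-AtomisticToContinuum-BECRewardDescent"]
def Assembly : Prop :=
  RewardScaleChord → RewardChordBound → PeriodicEnergyFinite → PeriodicRigidity → RigidCondensation → BoundaryTransferWeak → BoseEinsteinCondensation

-- `Assembly` holds: proved by `Summit.AtomisticToContinuum.BoseEinsteinCondensation.Theorems.becRewardDescent_assembly_proof` (its module imports this route file, so no `_holds` link can be stated here).

/-! D-0027 §2.1 — DECIDING THEOREM (planner-authored via `route open/edit --closes-file`; by planner-plancard-AtomisticToContinuum-BoseEin-029214b9-g2-0 2026-08-15T18:56:38Z):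
its hypotheses are this route's items and its conclusion the sub-problem Statement (glue_lint), and it elaborates with this file. -/

@[closes "route-AtomisticToContinuum-BECRewardDescent"] theorem closes (hRS : RewardScaleChord) (hCB : RewardChordBound) (hFin : PeriodicEnergyFinite)
    (hRig : PeriodicRigidity) (hRC : RigidCondensation) (hBT : BoundaryTransferWeak) :
    BoseEinsteinCondensation := by
  -- ℝ≥0∞ bookkeeping of the two rungs: chord(s) ≤ chord(s₀) + τN and chord(s₀) ≤ τN give
  -- R(s) ≤ E₀ + 2sτN once the finite term (s/s₀)·E₀ is cancelled.
  have alg : ∀ {Rs Rs₀ E₀ A B q : ENNReal}, E₀ ≠ ⊤ → q ≠ ⊤ →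
      Rs + q * E₀ ≤ E₀ + q * Rs₀ + A → Rs₀ ≤ E₀ + B → q * B = A → Rs ≤ E₀ + A + A := by
    intro Rs Rs₀ E₀ A B q hE hq hc hr hAB
    have h2 : Rs + q * E₀ ≤ (E₀ + A + A) + q * E₀ := by
      calc Rs + q * E₀ ≤ E₀ + q * Rs₀ + A := hc
        _ ≤ E₀ + q * (E₀ + B) + A := by gcongr
        _ = (E₀ + A + A) + q * E₀ := by rw [mul_add, hAB]; ring
    exact (ENNReal.add_le_add_iff_right (ENNReal.mul_ne_top hq hE)).1 h2
  intro v hv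
  apply hBT v hv
  obtain ⟨θ, ρ₁, hθ, hρ₁, hC⟩ := hCB v hv (1 / 8) (by norm_num)
  obtain ⟨ρ₂, hρ₂, hR⟩ := hRS v hv (1 / 8) θ (by norm_num) hθ
  obtain ⟨ρ₃, hρ₃, hF⟩ := hFin v hv
  obtain ⟨ρ₄, hρ₄, hG⟩ := hRig v hv
  refine ⟨min ρ₁ (min ρ₂ (min ρ₃ ρ₄)), lt_min hρ₁ (lt_min hρ₂ (lt_min hρ₃ hρ₄)),
    fun ρ hρ hρlt => ?_⟩
  have h1 : ρ < ρ₁ := lt_of_lt_of_le hρlt (min_le_left _ _)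
  have h2 : ρ < ρ₂ := lt_of_lt_of_le hρlt ((min_le_right _ _).trans (min_le_left _ _))
  have h3 : ρ < ρ₃ :=
    lt_of_lt_of_le hρlt ((min_le_right _ _).trans ((min_le_right _ _).trans (min_le_left _ _)))
  have h4 : ρ < ρ₄ :=
    lt_of_lt_of_le hρlt ((min_le_right _ _).trans ((min_le_right _ _).trans (min_le_right _ _)))
  refine ⟨1 - 2 * (2 * (1 / 8)), by norm_num, ?_⟩
  filter_upwards [hC ρ hρ h1, hR ρ hρ h2, hF ρ hρ h3, hG ρ hρ h4] with N hCN hRN hFN hGN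
  refine hRC v ρ N (2 * (1 / 8)) (by norm_num) hFN hGN ?_
  -- the walk's output in the form the rigidity step consumes: R(s) ≤ E₀ + s(2τ)N on (0, s₁]
  have hs₀ : 0 ≤ θ * ρ * (Literature.MathematicalPhysics.QuantumManyBody.BoseGas.scatteringLength v).toReal :=
    mul_nonneg (mul_nonneg hθ.le hρ.le) ENNReal.toReal_nonneg
  have hN : (0 : ℝ) ≤ N := N.cast_nonneg
  rcases hs₀.eq_or_lt with h0 | hpos
  · -- a = 0 (free gas): the reward-scale rung holds for every s > 0
    refine ⟨1, one_pos, fun s hs _ => ?_⟩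
    have h := hRN s hs (by rw [← h0]; exact hs.le)
    dsimp only at h ⊢
    have hle' : s * (1 / 8) * (N : ℝ) ≤ s * (2 * (1 / 8)) * N := by nlinarith
    exact h.trans (add_le_add le_rfl (ENNReal.ofReal_le_ofReal hle'))
  · -- a > 0: chord bound on (0, s₀] plus the reward-scale rung at s₀ = θρa
    have ha0 : (Literature.MathematicalPhysics.QuantumManyBody.BoseGas.scatteringLength v).toReal ≠ 0 := by
      intro h0'
      rw [h0', mul_zero] at hpos
      exact lt_irrefl _ hpos
    refine ⟨θ * ρ * (Literature.MathematicalPhysics.QuantumManyBody.BoseGas.scatteringLength v).toReal, hpos,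
      fun s hs hle => ?_⟩
    have hc := hCN s hs hle
    have hr := hRN _ hpos le_rfl
    dsimp only at hc hr ⊢
    have hq : 0 ≤ s / (θ * ρ * (Literature.MathematicalPhysics.QuantumManyBody.BoseGas.scatteringLength v).toReal) :=
      div_nonneg hs.le hpos.le
    have hAB : ENNReal.ofReal (s / (θ * ρ * (Literature.MathematicalPhysics.QuantumManyBody.BoseGas.scatteringLength v).toReal)) *
        ENNReal.ofReal (θ * ρ * (Literature.MathematicalPhysics.QuantumManyBody.BoseGas.scatteringLength v).toReal * (1 / 8) * N) =
        ENNReal.ofReal (s * (1 / 8) * N) := by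
      rw [← ENNReal.ofReal_mul hq]
      congr 1
      field_simp
    have h3 := alg hFN ENNReal.ofReal_ne_top hc hr hAB
    refine h3.trans (le_of_eq ?_)
    rw [add_assoc, ← ENNReal.ofReal_add (by positivity) (by positivity)]
    congr 2
    ring

end Summit.AtomisticToContinuum.BoseEinsteinCondensation.Theses.BECRewardDescent
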